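import Mathlib
import Summits.ValiantsHypothesis.ValiantsHypothesis.Theses.ScaledPencil

/-!
# `ScaledPencil.ScaledSameSize` (stmt-ValiantsHypothesis-5320), helper file: the closed fibre
# `{det(Λ + Σ_v x_v L_v) = per_n}`, its norm minimiser, and the two first-order identities

Route `ScaledPencil`, support item `ScaledSameSize` (analytic half of the normal form): if
`det(Λ + Σ_v x_v L_v) = per_n` for complex `m × m` matrices `Λ, L_v` (`v : Fin n × Fin n`), then
some `(Λ', L')` of the same size computes `per_n` and is operator-scaled and torus-balanced with
one constant `α > 0`.  This file carries the analysis and the "left" half of the algebra; the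
closing file `ScaledPencilScaledSameSize.lean` adds the mirror argument and assembles.

Configurations are `w : Option (Fin n × Fin n) → M_m(ℂ)` (`w none = Λ`, `w (some v) = L_v`);
"`w` lies in the fibre" is spelled `∀ x, (w none + ∑ v, x v • w (some v)).det = eval x per_n`
(the pencil of `w` computes `per_n` pointwise) and its squared norm `‖Λ‖_F² + Σ_v ‖L_v‖_F²` is
`∑ o, ∑ a, ∑ b, ‖w o a b‖ ^ 2`.

* `det_pencil_eq_iff`: `det(pencil) = per_n` in `MvPolynomial` iff it holds pointwise on `ℂ^(n×n)`
  (`MvPolynomial.funext`, `ℂ` infinite), so the fibre is closed (`det` is continuous).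
* `exists_min_nrm`: a nonempty fibre contains a minimiser of the norm (compact sublevel sets).
* `left_act_mem`: the fibre is stable under `(Λ, L_(i,j)) ↦ (PΛ, s_i • P L_(i,j))` whenever
  `det P · Π s_i = 1` (the permanent is multilinear in the rows of the variable matrix).
* `offdiag_eq_zero`: at a minimiser, transvections `P = 1 + u E_kl` (`det = 1`, all `u ∈ ℂ`)
  give `0 ≤ 2 Re(u A_lk) + |u|² C`, hence `A_lk = 0` for `k ≠ l`, `A = ΛΛᴴ + Σ_v L_v L_vᴴ`
  (`eq_zero_of_quad_ineq`).
* `diag_eq_row`: at a minimiser, `P = diag(1,…,μ,…,1)` compensated by the torus character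
  `s_(i₀) = μ⁻¹` (`|μ|² = t > 0`) gives `0 ≤ (t-1)a + (t⁻¹-1)b` with `a - b = A_kk - r_(i₀)`,
  hence `A_kk = r_(i₀) = Σ_j ‖L_(i₀,j)‖²` (`eq_of_scale_ineq`).

No calculus and no Lie theory are used: the first-order conditions of the Kempf–Ness function
are extracted from two explicit algebraic one-parameter families inside the group
`{(P, s) : det P · Π s_i = 1}`.
-/

noncomputable section

namespace Summit.ValiantsHypothesis.Theorems.ScaledSameSize

open Matrix MvPolynomial Finset
open Literature.Computability.AlgebraicComplexity

variable {n m : ℕ}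

/-! ## The pencil, its pointwise determinant, and the fibre over `per_n` -/

/-- Evaluating the determinant of the affine pencil `Λ + Σ_v X_v L_v` at a point `x` gives the
determinant of the complex matrix `Λ + Σ_v x_v L_v`. -/
theorem eval_det_pencil (Λ : Matrix (Fin m) (Fin m) ℂ)
    (L : Fin n × Fin n → Matrix (Fin m) (Fin m) ℂ) (x : Fin n × Fin n → ℂ) :
    MvPolynomial.eval x (Matrix.of fun a b => MvPolynomial.C (Λ a b) +
        ∑ v : Fin n × Fin n, MvPolynomial.C (L v a b) * MvPolynomial.X v).det =
      (Λ + ∑ v, x v • L v).det := by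
  rw [RingHom.map_det]
  congr 1
  ext a b
  simp [Matrix.sum_apply, mul_comm]

/-- The pencil computes `per_n` iff it does so pointwise (`ℂ` is infinite,
`MvPolynomial.funext`). -/
theorem det_pencil_eq_iff (Λ : Matrix (Fin m) (Fin m) ℂ)
    (L : Fin n × Fin n → Matrix (Fin m) (Fin m) ℂ) :
    (Matrix.of fun a b => MvPolynomial.C (Λ a b) +
        ∑ v : Fin n × Fin n, MvPolynomial.C (L v a b) * MvPolynomial.X v).det =
          perPoly (Fin n) ℂ ↔
      ∀ x : Fin n × Fin n → ℂ,
        (Λ + ∑ v, x v • L v).det = MvPolynomial.eval x (perPoly (Fin n) ℂ) := by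
  constructor
  · intro h x
    rw [← h, eval_det_pencil]
  · intro h
    apply MvPolynomial.funext
    intro x
    rw [eval_det_pencil, h]

/-- Row scaling of the variable matrix multiplies the permanent by the product of the scalars. -/
theorem eval_perPoly_row_scale (s : Fin n → ℂ) (x : Fin n × Fin n → ℂ) :
    MvPolynomial.eval (fun v => s v.1 * x v) (perPoly (Fin n) ℂ) =
      (∏ i, s i) * MvPolynomial.eval x (perPoly (Fin n) ℂ) := by
  rw [eval_perPoly, eval_perPoly]
  simp only [Matrix.permanent, Matrix.of_apply, Finset.prod_mul_distrib, Finset.mul_sum]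
  refine Finset.sum_congr rfl fun σ _ => ?_
  rw [Equiv.prod_comp σ s]

/-- The permanent is invariant under transposing the variable matrix. -/
theorem eval_perPoly_swap (x : Fin n × Fin n → ℂ) :
    MvPolynomial.eval (fun v => x v.swap) (perPoly (Fin n) ℂ) =
      MvPolynomial.eval x (perPoly (Fin n) ℂ) := by
  rw [eval_perPoly, eval_perPoly, ← Matrix.permanent_transpose]
  rfl

/-- `per_n(0) = 0` for `n ≥ 1`. -/
theorem eval_zero_perPoly (hn : 0 < n) :
    MvPolynomial.eval (fun _ => (0 : ℂ)) (perPoly (Fin n) ℂ) = 0 := by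
  haveI : Nonempty (Fin n) := ⟨⟨0, hn⟩⟩
  rw [eval_perPoly]
  exact Matrix.permanent_zero

/-- `per_n(1, …, 1) = n! ≠ 0`. -/
theorem eval_one_perPoly_ne_zero :
    MvPolynomial.eval (fun _ => (1 : ℂ)) (perPoly (Fin n) ℂ) ≠ 0 := by
  rw [eval_perPoly]
  simp only [Matrix.permanent, Matrix.of_apply, Finset.prod_const_one, Finset.sum_const,
    Finset.card_univ, nsmul_eq_mul, mul_one]
  exact Nat.cast_ne_zero.mpr Fintype.card_ne_zero

/-! ## Configurations `w : Option (Fin n × Fin n) → M_m(ℂ)` (`w none = Λ`, `w (some v) = L_v`) -/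

/-- A single entry is bounded by the total squared norm. -/
theorem sq_le_nrm (w : Option (Fin n × Fin n) → Matrix (Fin m) (Fin m) ℂ)
    (o : Option (Fin n × Fin n)) (a b : Fin m) :
    ‖w o a b‖ ^ 2 ≤ ∑ o, ∑ a, ∑ b, ‖w o a b‖ ^ 2 := by
  calc ‖w o a b‖ ^ 2 ≤ ∑ b', ‖w o a b'‖ ^ 2 :=
        Finset.single_le_sum (f := fun b' => ‖w o a b'‖ ^ 2) (fun _ _ => sq_nonneg _)
          (Finset.mem_univ b)
    _ ≤ ∑ a', ∑ b', ‖w o a' b'‖ ^ 2 :=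
        Finset.single_le_sum (f := fun a' => ∑ b', ‖w o a' b'‖ ^ 2)
          (fun _ _ => Finset.sum_nonneg fun _ _ => sq_nonneg _) (Finset.mem_univ a)
    _ ≤ ∑ o, ∑ a, ∑ b, ‖w o a b‖ ^ 2 :=
        Finset.single_le_sum (f := fun o' => ∑ a', ∑ b', ‖w o' a' b'‖ ^ 2)
          (fun _ _ => Finset.sum_nonneg fun _ _ => Finset.sum_nonneg fun _ _ => sq_nonneg _)
          (Finset.mem_univ o)

/-- **Existence of a minimal-norm point in the fibre.**  The fibre is closed and the squared norm
has compact sublevel sets, so a nonempty fibre contains a minimiser of the norm. -/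
theorem exists_min_nrm (w₀ : Option (Fin n × Fin n) → Matrix (Fin m) (Fin m) ℂ)
    (h₀ : ∀ x : Fin n × Fin n → ℂ,
      (w₀ none + ∑ v, x v • w₀ (some v)).det = MvPolynomial.eval x (perPoly (Fin n) ℂ)) :
    ∃ w : Option (Fin n × Fin n) → Matrix (Fin m) (Fin m) ℂ,
      (∀ x : Fin n × Fin n → ℂ,
        (w none + ∑ v, x v • w (some v)).det = MvPolynomial.eval x (perPoly (Fin n) ℂ)) ∧
      ∀ w' : Option (Fin n × Fin n) → Matrix (Fin m) (Fin m) ℂ,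
        (∀ x : Fin n × Fin n → ℂ,
          (w' none + ∑ v, x v • w' (some v)).det = MvPolynomial.eval x (perPoly (Fin n) ℂ)) →
        ∑ o, ∑ a, ∑ b, ‖w o a b‖ ^ 2 ≤ ∑ o, ∑ a, ∑ b, ‖w' o a b‖ ^ 2 := by
  set F := {w : Option (Fin n × Fin n) → Matrix (Fin m) (Fin m) ℂ | ∀ x : Fin n × Fin n → ℂ,
    (w none + ∑ v, x v • w (some v)).det = MvPolynomial.eval x (perPoly (Fin n) ℂ)} with hF_def
  have hF : IsClosed F := by
    simp only [hF_def, Set.setOf_forall]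
    refine isClosed_iInter fun x => isClosed_eq ?_ continuous_const
    refine Continuous.matrix_det ?_
    exact (continuous_apply none).add
      (continuous_finsetSum _ fun v _ => (continuous_apply (some v)).const_smul (x v))
  have hN : Continuous fun w : Option (Fin n × Fin n) → Matrix (Fin m) (Fin m) ℂ =>
      ∑ o, ∑ a, ∑ b, ‖w o a b‖ ^ 2 := by
    refine continuous_finsetSum _ fun o _ => continuous_finsetSum _ fun a _ =>
      continuous_finsetSum _ fun b _ => ?_
    exact (((continuous_apply o).matrix_elem a b).norm).pow 2
  set r : ℝ := Real.sqrt (∑ o, ∑ a, ∑ b, ‖w₀ o a b‖ ^ 2)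
  -- the box `‖w o a b‖ ≤ r` is compact
  have hS : @IsCompact (Matrix (Fin m) (Fin m) ℂ) _
      (Set.univ.pi fun _ : Fin m => Set.univ.pi fun _ : Fin m => Metric.closedBall (0 : ℂ) r) :=
    isCompact_univ_pi fun _ => isCompact_univ_pi fun _ => isCompact_closedBall _ _
  have hbox : IsCompact (Set.univ.pi fun _ : Option (Fin n × Fin n) =>
      (Set.univ.pi fun _ : Fin m => Set.univ.pi fun _ : Fin m => Metric.closedBall (0 : ℂ) r :
        Set (Matrix (Fin m) (Fin m) ℂ))) :=
    isCompact_univ_pi fun _ => hS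
  set K := F ∩ {w | ∑ o, ∑ a, ∑ b, ‖w o a b‖ ^ 2 ≤ ∑ o, ∑ a, ∑ b, ‖w₀ o a b‖ ^ 2} with hK_def
  have hK : IsCompact K := by
    refine hbox.of_isClosed_subset (hF.inter (isClosed_le hN continuous_const)) ?_
    rintro w ⟨-, hw⟩
    simp only [Set.mem_pi, Set.mem_univ, true_imp_iff, Metric.mem_closedBall, dist_zero_right]
    intro o a b
    exact Real.le_sqrt_of_sq_le ((sq_le_nrm w o a b).trans hw)
  have hK0 : w₀ ∈ K :=
    ⟨h₀, show ∑ o, ∑ a, ∑ b, ‖w₀ o a b‖ ^ 2 ≤ ∑ o, ∑ a, ∑ b, ‖w₀ o a b‖ ^ 2 from le_rfl⟩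
  obtain ⟨w, hwK, hmin⟩ := hK.exists_isMinOn ⟨w₀, hK0⟩ hN.continuousOn
  refine ⟨w, hwK.1, fun w' hw' => ?_⟩
  by_cases hle : ∑ o, ∑ a, ∑ b, ‖w' o a b‖ ^ 2 ≤ ∑ o, ∑ a, ∑ b, ‖w₀ o a b‖ ^ 2
  · exact hmin ⟨hw', hle⟩
  · exact hwK.2.trans (le_of_not_ge hle)

/-! ## Two scalar lemmas extracting first-order information -/

/-- If `0 ≤ (t-1)a + (t⁻¹-1)b` for all `t > 0` then `a = b` (test `t = (a+b)/(2a)`). -/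
theorem eq_of_scale_ineq {a b : ℝ} (h : ∀ t : ℝ, 0 < t → 0 ≤ (t - 1) * a + (t⁻¹ - 1) * b) :
    a = b := by
  have h2 := h 2 two_pos
  have h12 := h 2⁻¹ (by positivity)
  rw [inv_inv] at h12
  have ha : 0 ≤ a := by nlinarith
  have hb : 0 ≤ b := by nlinarith
  rcases ha.eq_or_lt with h0 | ha'
  · subst h0
    nlinarith
  · have ht : 0 < (a + b) / (2 * a) := by positivity
    have key := h _ ht
    rw [inv_div] at key
    have e : ((a + b) / (2 * a) - 1) * a + (2 * a / (a + b) - 1) * b =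
        -(a - b) ^ 2 / (2 * (a + b)) := by
      field_simp
      ring
    rw [e] at key
    have hab : 0 < 2 * (a + b) := by positivity
    have hsq : (a - b) ^ 2 ≤ 0 := by
      have := mul_nonneg key hab.le
      rw [div_mul_cancel₀ _ hab.ne'] at this
      linarith
    nlinarith [sq_nonneg (a - b)]

/-- If `0 ≤ 2 Re(u z) + |u|² C` for all `u ∈ ℂ` then `z = 0` (test `u = -ε conj z`). -/
theorem eq_zero_of_quad_ineq {z : ℂ} {C : ℝ}
    (h : ∀ u : ℂ, 0 ≤ 2 * (u * z).re + Complex.normSq u * C) : z = 0 := by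
  by_contra hz
  have hz2 : 0 < Complex.normSq z := Complex.normSq_pos.mpr hz
  set ε : ℝ := 1 / (|C| + 1) with hε
  have hεpos : 0 < ε := by positivity
  have key := h (-(ε : ℂ) * (starRingEnd ℂ) z)
  have h1 : (-(ε : ℂ) * (starRingEnd ℂ) z * z).re = -ε * Complex.normSq z := by
    rw [mul_assoc, ← Complex.normSq_eq_conj_mul_self, ← Complex.ofReal_neg, ← Complex.ofReal_mul,
      Complex.ofReal_re]
  have h2 : Complex.normSq (-(ε : ℂ) * (starRingEnd ℂ) z) = ε ^ 2 * Complex.normSq z := by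
    rw [Complex.normSq_mul, Complex.normSq_neg, Complex.normSq_ofReal, Complex.normSq_conj]
    ring
  rw [h1, h2] at key
  -- key : 0 ≤ 2 * (-ε * N) + ε² * N * C, i.e. ε N (ε C - 2) ≥ 0, but ε C ≤ |C|/(|C|+1) < 1
  have hC : ε * C ≤ 1 := by
    rw [hε, div_mul_eq_mul_div, one_mul, div_le_one (by positivity)]
    linarith [le_abs_self C]
  nlinarith [mul_pos hεpos hz2]

/-- `‖p + u q‖² = ‖p‖² + 2 Re(u q p̄) + |u|² ‖q‖²`. -/
theorem norm_add_mul_sq (p q u : ℂ) :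
    ‖p + u * q‖ ^ 2 =
      ‖p‖ ^ 2 + (2 * (u * (q * (starRingEnd ℂ) p)).re + Complex.normSq u * ‖q‖ ^ 2) := by
  rw [Complex.sq_norm, Complex.sq_norm, Complex.sq_norm, Complex.normSq_add, Complex.normSq_mul]
  have : p * (starRingEnd ℂ) (u * q) = (starRingEnd ℂ) (u * (q * (starRingEnd ℂ) p)) := by
    simp only [map_mul, Complex.conj_conj]
    ring
  rw [this, Complex.conj_re]
  ring

/-! ## The fibre is stable under the left action, and the two first-order identities -/

/-- The fibre is stable under `(Λ, L_(i,j)) ↦ (PΛ, s_i • P L_(i,j))` whenever `det P · ∏ s_i = 1`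
(the permanent is multilinear in the rows of the variable matrix). -/
theorem left_act_mem {w w' : Option (Fin n × Fin n) → Matrix (Fin m) (Fin m) ℂ}
    (hw : ∀ x : Fin n × Fin n → ℂ,
      (w none + ∑ v, x v • w (some v)).det = MvPolynomial.eval x (perPoly (Fin n) ℂ))
    (P : Matrix (Fin m) (Fin m) ℂ) (s : Fin n → ℂ) (hPs : P.det * ∏ i, s i = 1)
    (h0 : w' none = P * w none) (h1 : ∀ v, w' (some v) = s v.1 • (P * w (some v))) :
    ∀ x : Fin n × Fin n → ℂ,
      (w' none + ∑ v, x v • w' (some v)).det = MvPolynomial.eval x (perPoly (Fin n) ℂ) := by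
  intro x
  have key : w' none + ∑ v, x v • w' (some v) =
      P * (w none + ∑ v, (s v.1 * x v) • w (some v)) := by
    rw [h0, Matrix.mul_add, Matrix.mul_sum]
    congr 1
    refine Finset.sum_congr rfl fun v _ => ?_
    rw [h1, Matrix.mul_smul, smul_smul, mul_comm]
  rw [key, Matrix.det_mul, hw, eval_perPoly_row_scale, ← mul_assoc, hPs, one_mul]

/-- **Off-diagonal identity.** At a norm minimiser of the fibre, `A = ΛΛᴴ + Σ_v L_v L_vᴴ` has
vanishing off-diagonal entries: `A_lk = Σ_o Σ_b w_o(l,b) conj(w_o(k,b)) = 0` for `k ≠ l`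
(compare with the transvected configuration `(1 + u E_kl) • w`, `u ∈ ℂ`). -/
theorem offdiag_eq_zero {w : Option (Fin n × Fin n) → Matrix (Fin m) (Fin m) ℂ}
    (hw : ∀ x : Fin n × Fin n → ℂ,
      (w none + ∑ v, x v • w (some v)).det = MvPolynomial.eval x (perPoly (Fin n) ℂ))
    (hmin : ∀ w' : Option (Fin n × Fin n) → Matrix (Fin m) (Fin m) ℂ,
      (∀ x : Fin n × Fin n → ℂ,
        (w' none + ∑ v, x v • w' (some v)).det = MvPolynomial.eval x (perPoly (Fin n) ℂ)) →
      ∑ o, ∑ a, ∑ b, ‖w o a b‖ ^ 2 ≤ ∑ o, ∑ a, ∑ b, ‖w' o a b‖ ^ 2)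
    {k l : Fin m} (hkl : k ≠ l) :
    ∑ o, ∑ b, w o l b * (starRingEnd ℂ) (w o k b) = 0 := by
  apply eq_zero_of_quad_ineq (C := ∑ o, ∑ b, ‖w o l b‖ ^ 2)
  intro u
  set w' : Option (Fin n × Fin n) → Matrix (Fin m) (Fin m) ℂ :=
    fun o => transvection k l u * w o with hw'
  have hw'0 : w' none = transvection k l u * w none := rfl
  have hw'1 : ∀ v, w' (some v) = (1 : Fin n → ℂ) v.1 • (transvection k l u * w (some v)) :=
    fun v => by rw [Pi.one_apply, one_smul]
  have hmem : ∀ x : Fin n × Fin n → ℂ,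
      (w' none + ∑ v, x v • w' (some v)).det = MvPolynomial.eval x (perPoly (Fin n) ℂ) :=
    left_act_mem hw (transvection k l u) 1 (by simp [det_transvection_of_ne _ _ hkl]) hw'0 hw'1
  have h := hmin _ hmem
  have hw'o : ∀ o, w' o = transvection k l u * w o := fun o => rfl
  simp only [hw'o] at h
  have e1 : ∀ X : Matrix (Fin m) (Fin m) ℂ, ∑ a, ∑ b, ‖(transvection k l u * X) a b‖ ^ 2 =
      ∑ a, ∑ b, ‖X a b‖ ^ 2 +
        ∑ b, (2 * (u * (X l b * (starRingEnd ℂ) (X k b))).re + Complex.normSq u * ‖X l b‖ ^ 2) := by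
    intro X
    rw [← Finset.add_sum_erase _ (fun a => ∑ b, ‖(transvection k l u * X) a b‖ ^ 2)
        (Finset.mem_univ k),
      ← Finset.add_sum_erase _ (fun a => ∑ b, ‖X a b‖ ^ 2) (Finset.mem_univ k)]
    have hrest : ∑ a ∈ univ.erase k, ∑ b, ‖(transvection k l u * X) a b‖ ^ 2 =
        ∑ a ∈ univ.erase k, ∑ b, ‖X a b‖ ^ 2 := by
      refine Finset.sum_congr rfl fun a ha => ?_
      rw [Finset.mem_erase] at ha
      simp only [transvection_mul_apply_of_ne _ _ _ _ ha.1]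
    rw [hrest, add_right_comm, ← Finset.sum_add_distrib]
    congr 1
    refine Finset.sum_congr rfl fun b _ => ?_
    rw [transvection_mul_apply_same]
    exact norm_add_mul_sq _ _ _
  simp only [e1, Finset.sum_add_distrib] at h
  have hS2 : 2 * (u * ∑ o, ∑ b, w o l b * (starRingEnd ℂ) (w o k b)).re =
      ∑ o, ∑ b, 2 * (u * (w o l b * (starRingEnd ℂ) (w o k b))).re := by
    simp only [Finset.mul_sum, Complex.re_sum]
  have hS3 : Complex.normSq u * ∑ o, ∑ b, ‖w o l b‖ ^ 2 =
      ∑ o, ∑ b, Complex.normSq u * ‖w o l b‖ ^ 2 := by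
    simp only [Finset.mul_sum]
  rw [hS2, hS3]
  linarith

/-- **Diagonal identity.** At a norm minimiser of the fibre (with `n ≥ 1`), every diagonal entry
of `A = ΛΛᴴ + Σ_v L_v L_vᴴ` equals every row sum `r_i = Σ_j ‖L_(i,j)‖²`:
`Σ_o Σ_b ‖w_o(k,b)‖² = Σ_j ‖w_(i₀,j)‖²` (compare with `diag(1,…,μ,…,1) • w` compensated by the
torus character `s_(i₀) = μ⁻¹`, `|μ|² = t > 0`, and use `eq_of_scale_ineq`). -/
theorem diag_eq_row {w : Option (Fin n × Fin n) → Matrix (Fin m) (Fin m) ℂ}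
    (hw : ∀ x : Fin n × Fin n → ℂ,
      (w none + ∑ v, x v • w (some v)).det = MvPolynomial.eval x (perPoly (Fin n) ℂ))
    (hmin : ∀ w' : Option (Fin n × Fin n) → Matrix (Fin m) (Fin m) ℂ,
      (∀ x : Fin n × Fin n → ℂ,
        (w' none + ∑ v, x v • w' (some v)).det = MvPolynomial.eval x (perPoly (Fin n) ℂ)) →
      ∑ o, ∑ a, ∑ b, ‖w o a b‖ ^ 2 ≤ ∑ o, ∑ a, ∑ b, ‖w' o a b‖ ^ 2)
    (k : Fin m) (i₀ : Fin n) :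
    ∑ o, ∑ b, ‖w o k b‖ ^ 2 = ∑ j, ∑ a, ∑ b, ‖w (some (i₀, j)) a b‖ ^ 2 := by
  -- atoms: full masses `ρ` and row-`k` masses `κ`
  set K₀ : ℝ := ∑ j, ∑ b, ‖w (some (i₀, j)) k b‖ ^ 2 with hK₀
  set R₀ : ℝ := ∑ j, ∑ a, ∑ b, ‖w (some (i₀, j)) a b‖ ^ 2 with hR₀
  set K : ℝ := ∑ o, ∑ b, ‖w o k b‖ ^ 2 with hK
  suffices hineq : ∀ t : ℝ, 0 < t → 0 ≤ (t - 1) * (K - K₀) + (t⁻¹ - 1) * (R₀ - K₀) by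
    have := eq_of_scale_ineq hineq
    linarith
  intro t ht
  set μ : ℂ := ((Real.sqrt t : ℝ) : ℂ) with hμdef
  have hμ : ‖μ‖ ^ 2 = t := by
    rw [hμdef, Complex.norm_real, Real.norm_eq_abs, sq_abs, Real.sq_sqrt ht.le]
  have hμ0 : μ ≠ 0 := by
    intro h0
    rw [h0, norm_zero] at hμ
    simp at hμ
    linarith
  set D : Matrix (Fin m) (Fin m) ℂ := diagonal (Function.update (1 : Fin m → ℂ) k μ) with hD
  set s : Fin n → ℂ := Function.update (1 : Fin n → ℂ) i₀ μ⁻¹ with hs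
  have hchar : D.det * ∏ i, s i = 1 := by
    rw [hD, det_diagonal, Finset.prod_update_of_mem (Finset.mem_univ k), hs,
      Finset.prod_update_of_mem (Finset.mem_univ i₀)]
    simp [hμ0]
  set w' : Option (Fin n × Fin n) → Matrix (Fin m) (Fin m) ℂ :=
    fun o => Option.elim o (D * w none) (fun v => s v.1 • (D * w (some v))) with hw'
  have hw'0 : w' none = D * w none := rfl
  have hw'1 : ∀ v, w' (some v) = s v.1 • (D * w (some v)) := fun v => rfl
  have hmem : ∀ x : Fin n × Fin n → ℂ,
      (w' none + ∑ v, x v • w' (some v)).det = MvPolynomial.eval x (perPoly (Fin n) ℂ) :=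
    left_act_mem hw D s hchar hw'0 hw'1
  have h := hmin _ hmem
  -- per-matrix effect of `D`
  have hdiag : ∀ X : Matrix (Fin m) (Fin m) ℂ,
      ∑ a, ∑ b, ‖(D * X) a b‖ ^ 2 = ∑ a, ∑ b, ‖X a b‖ ^ 2 + (t - 1) * ∑ b, ‖X k b‖ ^ 2 := by
    intro X
    rw [← Finset.add_sum_erase _ (fun a => ∑ b, ‖(D * X) a b‖ ^ 2) (Finset.mem_univ k),
      ← Finset.add_sum_erase _ (fun a => ∑ b, ‖X a b‖ ^ 2) (Finset.mem_univ k)]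
    have h1 : ∑ b, ‖(D * X) k b‖ ^ 2 = t * ∑ b, ‖X k b‖ ^ 2 := by
      rw [Finset.mul_sum]
      refine Finset.sum_congr rfl fun b _ => ?_
      rw [hD, diagonal_mul, Function.update_self, norm_mul, mul_pow, hμ]
    have h2 : ∑ a ∈ univ.erase k, ∑ b, ‖(D * X) a b‖ ^ 2 =
        ∑ a ∈ univ.erase k, ∑ b, ‖X a b‖ ^ 2 := by
      refine Finset.sum_congr rfl fun a ha => ?_
      rw [Finset.mem_erase] at ha
      refine Finset.sum_congr rfl fun b _ => ?_
      rw [hD, diagonal_mul, Function.update_of_ne ha.1, Pi.one_apply, one_mul]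
    rw [h1, h2]
    ring
  -- effect of the torus weights
  have htorus : ∀ G : Fin n → ℝ, ∑ i, ‖s i‖ ^ 2 * G i = ∑ i, G i + (t⁻¹ - 1) * G i₀ := by
    intro G
    rw [← Finset.add_sum_erase _ (fun i => ‖s i‖ ^ 2 * G i) (Finset.mem_univ i₀),
      ← Finset.add_sum_erase _ G (Finset.mem_univ i₀)]
    have h1 : ‖s i₀‖ ^ 2 = t⁻¹ := by rw [hs, Function.update_self, norm_inv, inv_pow, hμ]
    have h2 : ∑ i ∈ univ.erase i₀, ‖s i‖ ^ 2 * G i = ∑ i ∈ univ.erase i₀, G i := by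
      refine Finset.sum_congr rfl fun i hi => ?_
      rw [Finset.mem_erase] at hi
      rw [hs, Function.update_of_ne hi.1, Pi.one_apply, norm_one, one_pow, one_mul]
    rw [h1, h2]
    ring
  -- the norm of the scaled configuration
  have hnrm' : ∑ o, ∑ a, ∑ b, ‖w' o a b‖ ^ 2 =
      ∑ o, ∑ a, ∑ b, ‖w o a b‖ ^ 2 + (t - 1) * K + (t⁻¹ - 1) * (R₀ + (t - 1) * K₀) := by
    have e1 : ∑ o, ∑ a, ∑ b, ‖w' o a b‖ ^ 2 = ∑ a, ∑ b, ‖(D * w none) a b‖ ^ 2 +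
        ∑ i, ‖s i‖ ^ 2 * ∑ j, ∑ a, ∑ b, ‖(D * w (some (i, j))) a b‖ ^ 2 := by
      rw [Fintype.sum_option, Fintype.sum_prod_type]
      simp only [hw'0, hw'1, Matrix.smul_apply, smul_eq_mul, norm_mul, mul_pow, Finset.mul_sum]
    rw [e1, htorus]
    simp only [hdiag]
    rw [hK, hR₀, hK₀, Fintype.sum_option, Fintype.sum_option, Fintype.sum_prod_type,
      Fintype.sum_prod_type]
    simp only [Finset.sum_add_distrib, ← Finset.mul_sum]
    ring
  rw [hnrm'] at h
  have hKK : t⁻¹ * t * K₀ = K₀ := by rw [inv_mul_cancel₀ ht.ne', one_mul]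
  nlinarith [h, hKK]

end Summit.ValiantsHypothesis.Theorems.ScaledSameSize
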